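import Mathlib.Analysis.Complex.ExponentialBounds
import HarnessLib

/-!
# The Lindemann–Weierstrass measure (Ably 1994, §II) — the `ε`-terms of (6)/(8): real arithmetic

`Literature/NumberTheory/Transcendental/LWMeasureSmallTermsEpsArith.lean` — proofs only (no
definitions, no named facts, nothing asserted). Real-arithmetic bookkeeping, over abstract real
constants, for the choice of parameters in the "Proposition principale" of M. Ably, *Une version
quantitative du théorème de Lindemann–Weierstrass*, Acta Arith. 67 (1994) 29–45, §II (4)–(8),
pp. 38–41 (named fact `Ably1994_lindemannWeierstrass_measure`): in the closed form (6) of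
`LWMeasure.Setup.norm_aeval_Qj_le_composite` (`LWMeasureSmallnessComposite.lean`) at
`ε = e^{-2R}`, `R_c = L`, the three terms carrying the factor `ε` — the coefficient term
`LD · 2^{n(b-1)} bⁿ H n(b-1) A^{n(b-1)} ε · (L+D)^s K₁^L A^{deg}` and the two Hermite terms
`|c|^L s! 𝓗(ρ+1)`, `|c|^L s! 𝓗(L) ((2ρ+1)/(L-ρ))^{T'Mⁿ}` — are each `≤ e^{-R-5}` for
`M ≥ M₀`, under the final relations `Mⁿ ≤ L`, `T'Mⁿ ≤ 8L`, `sMⁿ ≤ c_{ST} L`,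
`Mⁿ L log M ≤ R ≤ (5/4) L log L ≤ 5R`, `H ≤ LDbⁿ (L+D)^{T'} K₁^L`, `δ ≥ c_S/(nM)^{k_S}`: every
factor is `exp(O(R/Mⁿ) + O(1))` (`LWMeasure.small_terms_eps_aux`). The instance for Ably's data
is `LWMeasure.Setup.small_terms_eps` (`LWMeasureSmallTermsEps.lean`).

## References

* [Ably1994] M. Ably, *Une version quantitative du théorème de Lindemann–Weierstrass*, Acta Arith.
  67 (1994) 29–45, §II 2e pas, (4)–(8) pp. 38–41.
-/

noncomputable section

open scoped Nat

namespace Literature.NumberTheory.Transcendental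

namespace LWMeasure

/-! ### Products of factors bounded by exponentials -/

/-- `0 ≤ a ≤ e^x` and `0 ≤ b ≤ e^y` give `0 ≤ ab ≤ e^{x+y}`. [folklore] -/
private theorem bmul {a b x y : ℝ} (ha : 0 ≤ a ∧ a ≤ Real.exp x) (hb : 0 ≤ b ∧ b ≤ Real.exp y) :
    0 ≤ a * b ∧ a * b ≤ Real.exp (x + y) :=
  ⟨mul_nonneg ha.1 hb.1, by
    rw [Real.exp_add]; exact mul_le_mul ha.2 hb.2 hb.1 (Real.exp_pos x).le⟩

/-- `0 ≤ a ≤ e^x`, `b > 0`, `b⁻¹ ≤ e^y` give `0 ≤ a/b ≤ e^{x+y}`. [folklore] -/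
private theorem bdiv {a b x y : ℝ} (ha : 0 ≤ a ∧ a ≤ Real.exp x) (hb : 0 < b)
    (hb' : b⁻¹ ≤ Real.exp y) : 0 ≤ a / b ∧ a / b ≤ Real.exp (x + y) := by
  rw [div_eq_mul_inv]; exact bmul ha ⟨(inv_pos.mpr hb).le, hb'⟩

/-- `0 ≤ a ≤ e^x` gives `0 ≤ a^k ≤ e^{kx}`. [folklore] -/
private theorem bpow {a x : ℝ} (ha : 0 ≤ a ∧ a ≤ Real.exp x) (k : ℕ) :
    0 ≤ a ^ k ∧ a ^ k ≤ Real.exp (k * x) :=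
  ⟨pow_nonneg ha.1 k, by rw [Real.exp_nat_mul]; exact pow_le_pow_left₀ ha.1 ha.2 k⟩

/-- `0 ≤ a ≤ x` gives `0 ≤ a ≤ e^x`. [folklore] -/
private theorem ble {a x : ℝ} (h0 : 0 ≤ a) (h : a ≤ x) : 0 ≤ a ∧ a ≤ Real.exp x :=
  ⟨h0, h.trans ((le_add_of_nonneg_right zero_le_one).trans (Real.add_one_le_exp x))⟩

/-- `a > 0`, `log a ≤ x` give `0 ≤ a ≤ e^x`. [folklore] -/
private theorem blog {a x : ℝ} (h : 0 < a) (hx : Real.log a ≤ x) : 0 ≤ a ∧ a ≤ Real.exp x :=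
  ⟨h.le, (Real.exp_log h).ge.trans (Real.exp_le_exp.mpr hx)⟩

/-! ### The three `ε`-terms over abstract constants -/

/-- **The `ε`-terms of (6)/(8), abstract form.** With `ε = e^{-2R}`, `R_c = L` and real constants
`|c| ≥ 1`, `A ≥ 1`, `1 ≤ K₁ ≤ c_K M`, `1 ≤ ρ ≤ c_ρ M`, `deg ≤ c_deg M`, `Λ₀ = (δ ω^M)^{M^{n-1}}`
(`0 < ω ≤ 1`), `δ ≥ c_S/(nM)^{k_S}`, the three `ε`-terms of the closed form (6) are together
`≤ e^{-R}/2` for `M ≥ M₀` under the final parameter relations: every factor is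
`exp(O(R/Mⁿ) + O(1))` while `ε = exp(-2R)`. [cite: Ably1994, §II (6)–(8) pp. 39–41] -/
theorem small_terms_eps_aux (n d cST kS : ℕ) (hn : 1 ≤ n) {cS cabs A cK cρ cdeg ω : ℝ}
    (hcS : 0 < cS) (hcS1 : cS ≤ 1) (hc : 1 ≤ cabs) (hA : 1 ≤ A) (hcK : 1 ≤ cK) (hcρ : 1 ≤ cρ)
    (hcdeg : 0 ≤ cdeg) (hω : 0 < ω) (hω1 : ω ≤ 1) :
    ∃ M₀ : ℕ, ∀ (L D b M T' s dM : ℕ) (δ H R K1 ρ : ℝ),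
      1 ≤ K1 → K1 ≤ cK * M → 1 ≤ ρ → ρ ≤ cρ * M → (dM : ℝ) ≤ cdeg * M →
      M₀ ≤ M → M ^ n ≤ L → D ≤ 2 ^ (n + 4) * d → b ≤ D * M →
      T' * M ^ n ≤ 8 * L → s * M ^ n ≤ cST * L →
      (M : ℝ) ^ n * L * Real.log M ≤ R → R ≤ 5 / 4 * L * Real.log L → L * Real.log L ≤ 4 * R →
      0 ≤ H → H ≤ ((L * D * b ^ n : ℕ) : ℝ) * (((L : ℝ) + D) ^ T' * K1 ^ L) →
      0 < δ → cS / ((n : ℝ) * M) ^ kS ≤ δ →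
      (L : ℝ) * D * ((2 ^ (n * (b - 1)) * ((b : ℝ) ^ n * H) * ((n * (b - 1) : ℕ) : ℝ) *
          A ^ (n * (b - 1)) * Real.exp (-(2 * R))) * (((L : ℝ) + D) ^ s * K1 ^ L * A ^ dM)) +
      cabs ^ L * ((s.factorial : ℝ) *
          (((M ^ n : ℕ) : ℝ) * T' *
            ((L : ℝ) * D * ((2 ^ (n * (b - 1)) * ((b : ℝ) ^ n * H) * A ^ (n * (b - 1))) *
              (((L : ℝ) + D) ^ T' * K1 ^ L * (dM : ℝ) * A ^ dM * Real.exp (-(2 * R))))) *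
            (2 * (ρ + 1 + ρ)) ^ (T' * M ^ n) * (2 / δ) ^ T' /
              ((δ * ω ^ M) ^ (M ^ (n - 1))) ^ T')) +
      cabs ^ L * ((s.factorial : ℝ) *
          ((((M ^ n : ℕ) : ℝ) * T' *
              ((L : ℝ) * D * ((2 ^ (n * (b - 1)) * ((b : ℝ) ^ n * H) * A ^ (n * (b - 1))) *
              (((L : ℝ) + D) ^ T' * K1 ^ L * (dM : ℝ) * A ^ dM * Real.exp (-(2 * R))))) *
              (2 * ((L : ℝ) + ρ)) ^ (T' * M ^ n) * (2 / δ) ^ T' /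
                ((δ * ω ^ M) ^ (M ^ (n - 1))) ^ T') *
            ((ρ + 1 + ρ) / ((L : ℝ) - ρ)) ^ (T' * M ^ n))) ≤
        Real.exp (-R) / 2 := by
  -- the constants: `Dm` bounds `D`, `K` is the total coefficient of `u = R/Mⁿ` in the exponents
  obtain ⟨Dm, hDm⟩ : ∃ Dm : ℝ, Dm = 2 ^ (n + 4) * d := ⟨_, rfl⟩
  obtain ⟨K, hK⟩ : ∃ K : ℝ, K = 108 + Real.log cabs + 4 * cST + cST * Dm + 4 * n * Dm + 16 * Dm +
      2 * Real.log cK + n * Dm * Real.log A + cdeg + cdeg * Real.log A + 8 * Real.log (6 * cρ) +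
      16 * kS * Real.log n + 16 * kS - 16 * Real.log cS - 8 * Real.log ω := ⟨_, rfl⟩
  refine ⟨3 + cST + ⌈3 * cρ⌉₊ + ⌈2 * K⌉₊ + ⌈4 * Dm + 10⌉₊, ?_⟩
  intro L D b M T' s dM δ H R K1 ρ hK1 hK1' hρ hρ' hdM hM hL hDd hb hT' hs hR1 hR2 hR3 hH0 hH hδ hδ'
  /- 1. signs of the constants -/
  have hDm0 : 0 ≤ Dm := by rw [hDm]; positivity
  have hn0 : (0 : ℝ) < n := by exact_mod_cast hn
  have hn1 : (1 : ℝ) ≤ n := by exact_mod_cast hn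
  have hlc0 : 0 ≤ Real.log cabs := Real.log_nonneg hc
  have hlA0 : 0 ≤ Real.log A := Real.log_nonneg hA
  have hlK0 : 0 ≤ Real.log cK := Real.log_nonneg hcK
  have hlρ0 : 0 ≤ Real.log (6 * cρ) := Real.log_nonneg (by linarith only [hcρ])
  have hln0 : 0 ≤ Real.log n := Real.log_nonneg hn1
  have hlS0 : Real.log cS ≤ 0 := Real.log_nonpos hcS.le hcS1
  have hlω0 : Real.log ω ≤ 0 := Real.log_nonpos hω.le hω1
  have hkS0 : (0 : ℝ) ≤ kS := Nat.cast_nonneg _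
  have hcST0 : (0 : ℝ) ≤ cST := Nat.cast_nonneg _
  have hcρ0 : 0 < cρ := one_pos.trans_le hcρ
  /- 2. `M` is large; `Mⁿ ≤ L`; `log M, log L ≥ 1` -/
  have hM3 : (3 : ℝ) ≤ M := by exact_mod_cast (show 3 ≤ M by omega)
  have hMc : (cST : ℝ) ≤ M := by exact_mod_cast (show cST ≤ M by omega)
  have hMρ : 3 * cρ ≤ M :=
    (Nat.le_ceil _).trans (by exact_mod_cast (show ⌈3 * cρ⌉₊ ≤ M by omega))
  have hMK : 2 * K ≤ M := (Nat.le_ceil _).trans (by exact_mod_cast (show ⌈2 * K⌉₊ ≤ M by omega))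
  have hMD : 4 * Dm + 10 ≤ M :=
    (Nat.le_ceil _).trans (by exact_mod_cast (show ⌈4 * Dm + 10⌉₊ ≤ M by omega))
  have hM1 : (1 : ℝ) ≤ M := by linarith only [hM3]
  have hM0 : (0 : ℝ) < M := by linarith only [hM3]
  have hmM : (M : ℝ) ≤ (M : ℝ) ^ n := le_self_pow₀ hM1 (by omega)
  have hm1 : (1 : ℝ) ≤ (M : ℝ) ^ n := hM1.trans hmM
  have hm0 : (0 : ℝ) < (M : ℝ) ^ n := by positivity
  have hmL : (M : ℝ) ^ n ≤ L := by exact_mod_cast hL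
  have hL3 : (3 : ℝ) ≤ L := hM3.trans (hmM.trans hmL)
  have hL0 : (0 : ℝ) < L := by linarith only [hL3]
  have hL1 : (1 : ℝ) ≤ L := by linarith only [hL3]
  have he3 : Real.exp 1 ≤ 3 := Real.exp_one_lt_three.le
  have hlogM : 1 ≤ Real.log M := by rw [Real.le_log_iff_exp_le hM0]; linarith only [he3, hM3]
  have hlogM0 : 0 ≤ Real.log M := by linarith only [hlogM]
  have hlogL : 1 ≤ Real.log L := by rw [Real.le_log_iff_exp_le hL0]; linarith only [he3, hL3]
  have hlogL0 : 0 ≤ Real.log L := by linarith only [hlogL]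
  /- 3. `R`, `u = R / Mⁿ`, and every exponent piece is `≤ (const) u` -/
  have hR0 : (M : ℝ) ^ n * L ≤ R := by
    have h1 : (M : ℝ) ^ n * L * 1 ≤ (M : ℝ) ^ n * L * Real.log M :=
      mul_le_mul_of_nonneg_left hlogM (by positivity)
    linarith only [h1, hR1]
  have hLR : (L : ℝ) ≤ R := by
    have h1 := mul_le_mul_of_nonneg_right hm1 hL0.le
    linarith only [h1, hR0]
  have hmR : (M : ℝ) ^ n ≤ R := by
    have h1 := mul_le_mul_of_nonneg_left hL1 hm0.le
    linarith only [h1, hR0]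
  have hRpos : 0 < R := by linarith only [hL3, hLR]
  obtain ⟨u, hu⟩ : ∃ u : ℝ, u = R / (M : ℝ) ^ n := ⟨_, rfl⟩
  have hu0 : 0 ≤ u := by rw [hu]; positivity
  have hu_of : ∀ {a c : ℝ}, a * (M : ℝ) ^ n ≤ c * R → a ≤ c * u := fun h => by
    rw [hu, ← mul_div_assoc, le_div_iff₀ hm0]; exact h
  have pL : (L : ℝ) ≤ u := by
    have h1 := hu_of (a := L) (c := 1) (by linarith only [hR0]); linarith only [h1]
  have pLM : (L : ℝ) * Real.log M ≤ u := by
    have h1 := hu_of (a := L * Real.log M) (c := 1) (by linarith only [hR1]); linarith only [h1]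
  have pM : (M : ℝ) ≤ u := hmM.trans (hmL.trans pL)
  have hκ : (T' : ℝ) * (M : ℝ) ^ n ≤ 8 * L := by exact_mod_cast hT'
  have htL : (T' : ℝ) ≤ 8 * L := by
    have h1 := mul_le_mul_of_nonneg_left hm1 (Nat.cast_nonneg T'); linarith only [h1, hκ]
  have pt : (T' : ℝ) ≤ 8 * u := by linarith only [htL, pL]
  have ptM : (T' : ℝ) * Real.log M ≤ 8 * u :=
    (mul_le_mul_of_nonneg_right htL hlogM0).trans (by linarith only [pLM])
  have ptlog : (T' : ℝ) * Real.log L ≤ 32 * u := by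
    refine hu_of ?_
    have h1 := mul_le_mul_of_nonneg_right hκ hlogL0
    linarith only [h1, hR3]
  have hsm : (s : ℝ) * (M : ℝ) ^ n ≤ cST * L := by exact_mod_cast hs
  have hsL : (s : ℝ) ≤ L := by
    refine le_of_mul_le_mul_right (hsm.trans ?_) hm0
    rw [mul_comm]
    exact mul_le_mul_of_nonneg_left (hMc.trans hmM) hL0.le
  have psu : (s : ℝ) ≤ cST * u := by
    have h1 := mul_le_mul_of_nonneg_left hm1 (Nat.cast_nonneg s)
    have h2 := mul_le_mul_of_nonneg_left pL hcST0
    linarith only [h1, h2, hsm]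
  have pslog : (s : ℝ) * Real.log L ≤ 4 * cST * u := by
    refine hu_of ?_
    have h1 := mul_le_mul_of_nonneg_right hsm hlogL0
    have h2 := mul_le_mul_of_nonneg_left hR3 hcST0
    linarith only [h1, h2]
  have hDDm : (D : ℝ) ≤ Dm := by rw [hDm]; exact_mod_cast hDd
  have hbu : (b : ℝ) ≤ Dm * u := by
    have h1 : (b : ℝ) ≤ D * M := by exact_mod_cast hb
    have h2 := mul_le_mul_of_nonneg_right hDDm hM0.le
    have h3 := mul_le_mul_of_nonneg_left pM hDm0
    linarith only [h1, h2, h3]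
  have pnb : (n : ℝ) * b ≤ n * (Dm * u) := mul_le_mul_of_nonneg_left hbu hn0.le
  have pN1 : ((n * (b - 1) : ℕ) : ℝ) ≤ n * (Dm * u) := by
    refine le_trans ?_ pnb
    exact_mod_cast Nat.mul_le_mul_left n (Nat.sub_le b 1)
  have pN1A : ((n * (b - 1) : ℕ) : ℝ) * Real.log A ≤ n * (Dm * u) * Real.log A :=
    mul_le_mul_of_nonneg_right pN1 hlA0
  have hdMu : (dM : ℝ) ≤ cdeg * u := hdM.trans (mul_le_mul_of_nonneg_left pM hcdeg)
  have pdMA : (dM : ℝ) * Real.log A ≤ cdeg * u * Real.log A := mul_le_mul_of_nonneg_right hdMu hlA0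
  have ptDm : (T' : ℝ) * Dm ≤ 8 * u * Dm := mul_le_mul_of_nonneg_right pt hDm0
  have psDm : (s : ℝ) * Dm ≤ cST * u * Dm := mul_le_mul_of_nonneg_right psu hDm0
  have pLcK : (L : ℝ) * Real.log cK ≤ u * Real.log cK := mul_le_mul_of_nonneg_right pL hlK0
  have pLc : (L : ℝ) * Real.log cabs ≤ u * Real.log cabs := mul_le_mul_of_nonneg_right pL hlc0
  have ptn : (T' : ℝ) * (kS * Real.log n) ≤ 8 * u * (kS * Real.log n) :=
    mul_le_mul_of_nonneg_right pt (mul_nonneg hkS0 hln0)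
  have ptkM : (kS : ℝ) * (T' * Real.log M) ≤ kS * (8 * u) := mul_le_mul_of_nonneg_left ptM hkS0
  have ptS : -Real.log cS * T' ≤ -Real.log cS * (8 * u) :=
    mul_le_mul_of_nonneg_left pt (by linarith only [hlS0])
  -- `κ = T' Mⁿ ≤ 8L`
  have hκ' : ((T' * M ^ n : ℕ) : ℝ) ≤ 8 * L := by exact_mod_cast hT'
  have pκρ : ((T' * M ^ n : ℕ) : ℝ) * Real.log (6 * cρ) ≤ 8 * u * Real.log (6 * cρ) :=
    mul_le_mul_of_nonneg_right (hκ'.trans (by linarith only [pL])) hlρ0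
  have pκM : ((T' * M ^ n : ℕ) : ℝ) * Real.log M ≤ 8 * u :=
    (mul_le_mul_of_nonneg_right hκ' hlogM0).trans (by linarith only [pLM])
  have pκ3 : ((T' * M ^ n : ℕ) : ℝ) * Real.log 3 ≤ 16 * u := by
    have h3 : Real.log 3 ≤ 2 := (Real.log_le_sub_one_of_pos (by norm_num)).trans (by norm_num)
    have h1 := mul_le_mul_of_nonneg_left h3 (Nat.cast_nonneg (T' * M ^ n))
    linarith only [h1, hκ', pL]
  -- `q = T' M^{n-1}`: `q M = T' Mⁿ ≤ 8L`
  have hpM : ((M ^ (n - 1) : ℕ) : ℝ) * M = (M : ℝ) ^ n := by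
    push_cast
    rw [← pow_succ, Nat.sub_add_cancel hn]
  have hq0 : 0 ≤ (T' : ℝ) * ((M ^ (n - 1) : ℕ) : ℝ) := by positivity
  have hqM : (T' : ℝ) * ((M ^ (n - 1) : ℕ) : ℝ) * M ≤ 8 * u := by
    rw [mul_assoc, hpM]; linarith only [hκ, pL]
  have hq : (T' : ℝ) * ((M ^ (n - 1) : ℕ) : ℝ) ≤ 8 * u := by
    have h1 := mul_le_mul_of_nonneg_left hM1 hq0
    linarith only [h1, hqM]
  have hqlog : (T' : ℝ) * ((M ^ (n - 1) : ℕ) : ℝ) * Real.log M ≤ 8 * u := by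
    have h1 : Real.log M ≤ M * Real.log M := by
      have h2 := mul_le_mul_of_nonneg_right hM1 hlogM0; linarith only [h2]
    calc (T' : ℝ) * ((M ^ (n - 1) : ℕ) : ℝ) * Real.log M
        ≤ (T' : ℝ) * ((M ^ (n - 1) : ℕ) : ℝ) * (M * Real.log M) := mul_le_mul_of_nonneg_left h1 hq0
      _ = (T' : ℝ) * (M : ℝ) ^ n * Real.log M := by rw [← hpM]; ring
      _ ≤ 8 * L * Real.log M := mul_le_mul_of_nonneg_right hκ hlogM0
      _ ≤ 8 * u := by linarith only [pLM]
  have pqn : (T' : ℝ) * ((M ^ (n - 1) : ℕ) : ℝ) * (kS * Real.log n) ≤ 8 * u * (kS * Real.log n) :=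
    mul_le_mul_of_nonneg_right hq (mul_nonneg hkS0 hln0)
  have pqM : (kS : ℝ) * ((T' : ℝ) * ((M ^ (n - 1) : ℕ) : ℝ) * Real.log M) ≤ kS * (8 * u) :=
    mul_le_mul_of_nonneg_left hqlog hkS0
  have pqS : -Real.log cS * ((T' : ℝ) * ((M ^ (n - 1) : ℕ) : ℝ)) ≤ -Real.log cS * (8 * u) :=
    mul_le_mul_of_nonneg_left hq (by linarith only [hlS0])
  have pqω : -Real.log ω * ((T' : ℝ) * ((M ^ (n - 1) : ℕ) : ℝ) * M) ≤ -Real.log ω * (8 * u) :=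
    mul_le_mul_of_nonneg_left hqM (by linarith only [hlω0])
  /- 4. `L ≥ 2 c_ρ M ≥ 2ρ` (from `Mⁿ L log M ≤ R ≤ (5/4) L log L`) -/
  have h2ρ : 2 * cρ * M ≤ L := by
    have h0 : (M : ℝ) ^ n * Real.log M ≤ 5 / 4 * Real.log L := by
      refine le_of_mul_le_mul_right ?_ hL0
      linarith only [hR1, hR2]
    have h1 : Real.log (2 * cρ * M) ≤ Real.log L := by
      rw [Real.log_mul (mul_pos two_pos hcρ0).ne' hM0.ne']
      have h2 : Real.log (2 * cρ) ≤ 2 * cρ - 1 := Real.log_le_sub_one_of_pos (mul_pos two_pos hcρ0)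
      have h3 : (4 / 5 * M - 1) * 1 ≤ (4 / 5 * M - 1) * Real.log M :=
        mul_le_mul_of_nonneg_left hlogM (by linarith only [hM3])
      have h4 : (M : ℝ) * Real.log M ≤ (M : ℝ) ^ n * Real.log M :=
        mul_le_mul_of_nonneg_right hmM hlogM0
      linarith only [h0, h2, h3, h4, hMρ, hM3]
    exact (Real.log_le_log_iff (by positivity) hL0).mp h1
  have hρL : 2 * ρ ≤ L := by
    have h1 := mul_le_mul_of_nonneg_left hρ' zero_le_two; linarith only [h1, h2ρ]
  have hLρ0 : 0 < (L : ℝ) - ρ := by linarith only [hρL, hρ]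
  /- 5. every factor is `≤ exp(⋯)` -/
  have hApos : 0 < A := one_pos.trans_le hA
  have bLn : 0 ≤ (L : ℝ) ∧ (L : ℝ) ≤ Real.exp L := ble hL0.le le_rfl
  have bD : 0 ≤ (D : ℝ) ∧ (D : ℝ) ≤ Real.exp Dm := ble (Nat.cast_nonneg _) hDDm
  have bb : 0 ≤ (b : ℝ) ^ n ∧ (b : ℝ) ^ n ≤ Real.exp (n * b) :=
    bpow (ble (Nat.cast_nonneg _) le_rfl) n
  have bLD : 0 ≤ (L : ℝ) + D ∧ (L : ℝ) + D ≤ Real.exp (Real.log L + Dm) := by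
    refine blog (by positivity) ?_
    have h1 : (L : ℝ) + D ≤ L * (1 + D) := by
      have h2 := mul_le_mul_of_nonneg_right hL1 (Nat.cast_nonneg D); linarith only [h2]
    have h2 : Real.log (1 + (D : ℝ)) ≤ D :=
      (Real.log_le_sub_one_of_pos (by positivity)).trans (le_of_eq (by ring))
    calc Real.log ((L : ℝ) + D) ≤ Real.log (L * (1 + D)) := Real.log_le_log (by positivity) h1
      _ = Real.log L + Real.log (1 + (D : ℝ)) := Real.log_mul hL0.ne' (by positivity)
      _ ≤ Real.log L + Dm := by linarith only [h2, hDDm]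
  have hK10 : 0 < K1 := one_pos.trans_le hK1
  have bK1 : 0 ≤ K1 ∧ K1 ≤ Real.exp (Real.log cK + Real.log M) := by
    refine blog hK10 ?_
    rw [← Real.log_mul (one_pos.trans_le hcK).ne' hM0.ne']
    exact Real.log_le_log hK10 hK1'
  have bLDT := bpow bLD T'
  have bK1L := bpow bK1 L
  have hH' : H ≤ (L : ℝ) * D * (b : ℝ) ^ n * (((L : ℝ) + D) ^ T' * K1 ^ L) := by
    push_cast at hH; exact hH
  have bH := And.intro hH0 (hH'.trans (bmul (bmul (bmul bLn bD) bb) (bmul bLDT bK1L)).2)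
  have bE : 0 ≤ Real.exp (-(2 * R)) ∧ Real.exp (-(2 * R)) ≤ Real.exp (-(2 * R)) :=
    ⟨(Real.exp_pos _).le, le_rfl⟩
  have h2e : 0 ≤ (2 : ℝ) ∧ (2 : ℝ) ≤ Real.exp 1 :=
    ⟨zero_le_two, by linarith only [Real.add_one_le_exp (1 : ℝ)]⟩
  have b2 := bpow h2e (n * (b - 1))
  have bN : 0 ≤ ((n * (b - 1) : ℕ) : ℝ) ∧ ((n * (b - 1) : ℕ) : ℝ) ≤
      Real.exp ((n * (b - 1) : ℕ) : ℝ) := ble (Nat.cast_nonneg _) le_rfl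
  have bAe := bpow (blog hApos le_rfl) (n * (b - 1))
  have bAd := bpow (blog hApos le_rfl) dM
  have bLDs := bpow bLD s
  have bcL := bpow (blog (one_pos.trans_le hc) le_rfl) L
  have bmt : 0 ≤ ((M ^ n : ℕ) : ℝ) * (T' : ℝ) ∧ ((M ^ n : ℕ) : ℝ) * (T' : ℝ) ≤ Real.exp (8 * L) :=
    ble (by positivity) (by push_cast; linarith only [hκ])
  have bdM : 0 ≤ (dM : ℝ) ∧ (dM : ℝ) ≤ Real.exp (cdeg * u) := ble (Nat.cast_nonneg _) hdMu
  have bsf : 0 ≤ (s ! : ℝ) ∧ (s ! : ℝ) ≤ Real.exp (s * Real.log L) := by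
    refine ⟨Nat.cast_nonneg _, ?_⟩
    calc (s ! : ℝ) ≤ ((s ^ s : ℕ) : ℝ) := by exact_mod_cast Nat.factorial_le_pow s
      _ = (s : ℝ) ^ s := by push_cast; rfl
      _ ≤ (L : ℝ) ^ s := pow_le_pow_left₀ (Nat.cast_nonneg _) hsL s
      _ ≤ Real.exp (s * Real.log L) := (bpow (blog hL0 le_rfl) s).2
  -- the Hermite factors `(2(2ρ+1))^{T'Mⁿ}`, `(2(L+ρ))^{T'Mⁿ}`, `((2ρ+1)/(L-ρ))^{T'Mⁿ}`
  have h6 : 6 * cρ * (M : ℝ) = Real.exp (Real.log (6 * cρ) + Real.log M) := by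
    rw [Real.exp_add, Real.exp_log (by positivity), Real.exp_log hM0]
  have bW1 : 0 ≤ 2 * (ρ + 1 + ρ) ∧ 2 * (ρ + 1 + ρ) ≤ Real.exp (Real.log (6 * cρ) + Real.log M) := by
    refine ⟨by linarith only [hρ], ?_⟩
    rw [← h6]
    have h1 := mul_le_mul_of_nonneg_left hρ' (by norm_num : (0 : ℝ) ≤ 6)
    linarith only [h1, hρ]
  have bW3 : 0 ≤ 2 * ((L : ℝ) + ρ) ∧ 2 * ((L : ℝ) + ρ) ≤ Real.exp (Real.log 3 + Real.log L) := by
    refine ⟨by linarith only [hL0, hρ], ?_⟩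
    rw [Real.exp_add, Real.exp_log (by norm_num), Real.exp_log hL0]
    linarith only [hρL]
  have bY : 0 ≤ (ρ + 1 + ρ) / ((L : ℝ) - ρ) ∧
      (ρ + 1 + ρ) / ((L : ℝ) - ρ) ≤ Real.exp (Real.log (6 * cρ) + Real.log M - Real.log L) := by
    refine ⟨div_nonneg (by linarith only [hρ]) hLρ0.le, ?_⟩
    rw [Real.exp_sub, ← h6, Real.exp_log hL0, div_le_div_iff₀ hLρ0 hL0]
    have h1 := mul_le_mul_of_nonneg_left hρL (by positivity : (0 : ℝ) ≤ cρ * M)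
    have h2 := mul_le_mul_of_nonneg_right hρ' hL0.le
    have h3 := mul_le_mul_of_nonneg_right hρ hL0.le
    linarith only [h1, h2, h3]
  -- `(2/δ)^{T'}` and `1/Λ₀^{T'}`, `Λ₀ = (δ ω^M)^{M^{n-1}}`
  have bδi : 0 ≤ δ⁻¹ ∧ δ⁻¹ ≤ Real.exp (kS * (Real.log n + Real.log M) - Real.log cS) := by
    refine blog (inv_pos.mpr hδ) ?_
    have h1 : δ⁻¹ ≤ ((n : ℝ) * M) ^ kS / cS := by
      rw [← inv_div]
      exact inv_anti₀ (by positivity) hδ'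
    calc Real.log δ⁻¹ ≤ Real.log (((n : ℝ) * M) ^ kS / cS) :=
          Real.log_le_log (inv_pos.mpr hδ) h1
      _ = kS * (Real.log n + Real.log M) - Real.log cS := by
          rw [Real.log_div (by positivity) hcS.ne', Real.log_pow, Real.log_mul hn0.ne' hM0.ne']
  have bωi : 0 ≤ ω⁻¹ ∧ ω⁻¹ ≤ Real.exp (-Real.log ω) := blog (inv_pos.mpr hω) (Real.log_inv ω).le
  have bV := bmul h2e bδi
  rw [← div_eq_mul_inv] at bV
  have bVT := bpow bV T'
  have bΛ := bpow (bpow (bmul bδi (bpow bωi M)) (M ^ (n - 1))) T'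
  rw [inv_pow, ← mul_inv, inv_pow, inv_pow] at bΛ
  have hΛ0 : 0 < ((δ * ω ^ M) ^ (M ^ (n - 1))) ^ T' := by positivity
  have bW1p := bpow bW1 (T' * M ^ n)
  have bW3p := bpow bW3 (T' * M ^ n)
  have bYp := bpow bY (T' * M ^ n)
  /- 6. the three terms -/
  have bTA := bmul (bmul bLn bD)
    (bmul (bmul (bmul (bmul (bmul b2 (bmul bb bH)) bN) bAe) bE) (bmul (bmul bLDs bK1L) bAd))
  have bεH := bmul (bmul bLn bD)
    (bmul (bmul (bmul b2 (bmul bb bH)) bAe) (bmul (bmul (bmul (bmul bLDT bK1L) bdM) bAd) bE))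
  have bTB := bmul bcL (bmul bsf (bdiv (bmul (bmul (bmul bmt bεH) bW1p) bVT) hΛ0 bΛ.2))
  have bTD := bmul bcL (bmul bsf (bmul (bdiv (bmul (bmul (bmul bmt bεH) bW3p) bVT) hΛ0 bΛ.2) bYp))
  /- 7. the exponents are `≤ -R - 5`, and `3 e^{-R-5} ≤ e^{-R}/2` -/
  have hKu : K * u ≤ R / 2 := by
    rw [hu, ← mul_div_assoc, div_le_iff₀ hm0]
    have h1 := mul_le_mul_of_nonneg_left (hMK.trans hmM) (by positivity : (0 : ℝ) ≤ R / 2)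
    linarith only [h1]
  rw [hK] at hKu
  have hR10 : 4 * Dm + 10 ≤ R := hMD.trans (hmM.trans hmR)
  have n1 : 0 ≤ u * Real.log cabs := mul_nonneg hu0 hlc0
  have n2 : 0 ≤ u * Dm := mul_nonneg hu0 hDm0
  have n3 : 0 ≤ u * cdeg := mul_nonneg hu0 hcdeg
  have n4 : 0 ≤ u * Real.log (6 * cρ) := mul_nonneg hu0 hlρ0
  have n5 : 0 ≤ u * (kS * Real.log n) := mul_nonneg hu0 (mul_nonneg hkS0 hln0)
  have n6 : 0 ≤ u * kS := mul_nonneg hu0 hkS0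
  have n7 : u * Real.log cS ≤ 0 := mul_nonpos_of_nonneg_of_nonpos hu0 hlS0
  have n8 : u * Real.log ω ≤ 0 := mul_nonpos_of_nonneg_of_nonpos hu0 hlω0
  have n9 : 0 ≤ u * (cST * Dm) := mul_nonneg hu0 (mul_nonneg hcST0 hDm0)
  have n10 : 0 ≤ u * (n * Dm) := mul_nonneg hu0 (mul_nonneg hn0.le hDm0)
  have n11 : 0 ≤ u * cST := mul_nonneg hu0 hcST0
  have n12 : 0 ≤ u * Real.log cK := mul_nonneg hu0 hlK0
  have n13 : 0 ≤ u * (n * Dm * Real.log A) := mul_nonneg hu0 (by positivity)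
  have n14 : 0 ≤ u * (cdeg * Real.log A) := mul_nonneg hu0 (mul_nonneg hcdeg hlA0)
  have key : ∀ {a x : ℝ}, 0 ≤ a ∧ a ≤ Real.exp x → x ≤ -R - 5 → a ≤ Real.exp (-R - 5) :=
    fun h hx => h.2.trans (Real.exp_le_exp.mpr hx)
  have e5 : 6 * Real.exp (-R - 5) ≤ Real.exp (-R) := by
    have h1 : Real.exp (-R) = Real.exp (-R - 5) * Real.exp 5 := by
      rw [← Real.exp_add]; ring_nf
    rw [h1]
    have h2 := mul_le_mul_of_nonneg_left (Real.add_one_le_exp 5) (Real.exp_pos (-R - 5)).le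
    linarith only [h2]
  refine le_trans (add_le_add (add_le_add (key bTA ?_) (key bTB ?_)) (key bTD ?_))
    (by linarith only [e5])
  · linarith only [pL, pN1, pnb, ptlog, ptDm, pLcK, pLM, pN1A, pslog, psDm, pdMA, hKu, hR10, hu0,
      n1, n2, n3, n4, n5, n6, n7, n8, n9, n10, n11, n12, n13, n14]
  · linarith only [pLc, pslog, pL, pN1, pnb, ptlog, ptDm, pLcK, pLM, pN1A, pdMA, pκρ, pκM, pt, ptn,
      ptkM, ptS, pqn, pqM, pqS, pqω, hKu, hR10, hu0,
      n1, n2, n3, n4, n5, n6, n7, n8, n9, n10, n11, n12, n13, n14]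
  · linarith only [pLc, pslog, pL, pN1, pnb, ptlog, ptDm, pLcK, pLM, pN1A, pdMA, pκρ, pκM, pκ3, pt,
      ptn, ptkM, ptS, pqn, pqM, pqS, pqω, hKu, hR10, hu0,
      n1, n2, n3, n4, n5, n6, n7, n8, n9, n10, n11, n12, n13, n14]

end LWMeasure

end Literature.NumberTheory.Transcendental

end
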